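import Literature.NumberTheory.LFunctions.WeilTwoPrimeDeflL2Base
import Literature.NumberTheory.LFunctions.WeilBlockRowsPZ
import HarnessLib

/-!
# Deflated two-prime certificate L2: the factored even inverse agrees with `D`, rows 104–111

`WeilCert.checkDnRow` (even block) for certificate L2, by `decide +kernel`. Pure proof file.
-/

noncomputable section

namespace Literature.NumberTheory.LFunctions

set_option maxHeartbeats 0 in
/-- Row 104 of `DnE/LsE` is row 104 of the even `D` (certificate L2). [folklore] -/
theorem checkDnRow0_104_weilCertDeflL2 : weilCertDeflL2Base.checkDnRow weilCertDeflL2DnE weilCertDeflL2LsE 0 104 = true := by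
  decide +kernel

set_option maxHeartbeats 0 in
/-- Row 105 of `DnE/LsE` is row 105 of the even `D` (certificate L2). [folklore] -/
theorem checkDnRow0_105_weilCertDeflL2 : weilCertDeflL2Base.checkDnRow weilCertDeflL2DnE weilCertDeflL2LsE 0 105 = true := by
  decide +kernel

set_option maxHeartbeats 0 in
/-- Row 106 of `DnE/LsE` is row 106 of the even `D` (certificate L2). [folklore] -/
theorem checkDnRow0_106_weilCertDeflL2 : weilCertDeflL2Base.checkDnRow weilCertDeflL2DnE weilCertDeflL2LsE 0 106 = true := by
  decide +kernel

set_option maxHeartbeats 0 in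
/-- Row 107 of `DnE/LsE` is row 107 of the even `D` (certificate L2). [folklore] -/
theorem checkDnRow0_107_weilCertDeflL2 : weilCertDeflL2Base.checkDnRow weilCertDeflL2DnE weilCertDeflL2LsE 0 107 = true := by
  decide +kernel

set_option maxHeartbeats 0 in
/-- Row 108 of `DnE/LsE` is row 108 of the even `D` (certificate L2). [folklore] -/
theorem checkDnRow0_108_weilCertDeflL2 : weilCertDeflL2Base.checkDnRow weilCertDeflL2DnE weilCertDeflL2LsE 0 108 = true := by
  decide +kernel

set_option maxHeartbeats 0 in
/-- Row 109 of `DnE/LsE` is row 109 of the even `D` (certificate L2). [folklore] -/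
theorem checkDnRow0_109_weilCertDeflL2 : weilCertDeflL2Base.checkDnRow weilCertDeflL2DnE weilCertDeflL2LsE 0 109 = true := by
  decide +kernel

set_option maxHeartbeats 0 in
/-- Row 110 of `DnE/LsE` is row 110 of the even `D` (certificate L2). [folklore] -/
theorem checkDnRow0_110_weilCertDeflL2 : weilCertDeflL2Base.checkDnRow weilCertDeflL2DnE weilCertDeflL2LsE 0 110 = true := by
  decide +kernel

set_option maxHeartbeats 0 in
/-- Row 111 of `DnE/LsE` is row 111 of the even `D` (certificate L2). [folklore] -/
theorem checkDnRow0_111_weilCertDeflL2 : weilCertDeflL2Base.checkDnRow weilCertDeflL2DnE weilCertDeflL2LsE 0 111 = true := by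
  decide +kernel


end Literature.NumberTheory.LFunctions
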